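import Literature.AnabelianGeometry.EtaleTheta.Discharge.Sec2CuspDecompModel
import Literature.AnabelianGeometry.EtaleTheta.Discharge.Sec2SlimPiTpC
import Literature.AnabelianGeometry.EtaleTheta.Discharge.Sec2HasMuLOfSetting
import Literature.AnabelianGeometry.EtaleTheta.SettingBridgeCuspLaws
import HarnessLib

/-!
# [EtTh] Cor. 2.9 AT THE §1 MODEL — END KNIT: the labels-of-cusps count for the assembled cover under print's
# own hypotheses, every auxiliary binder of this lineage discharged (proof-only)

Mochizuki, *The étale theta function and its Frobenioid-theoretic manifestations*, Publ. RIMS **45**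
(2009), §2, Cor. 2.9 p. 43: "Suppose that `K` contains a primitive `l`-th root of unity. Then for each of
`Ẋ̲̲, Ċ̲, Ċ̲̲, X̲̲, C̲, C̲̲` the labels determine a bijection of `(ℤ/lℤ)^±` with the set of `Aut_K(−)`-orbits of the
cusps" [cite: MochizukiEtTh2009, Cor 2.9 p.43]; Rmk. 2.6.1 p. 40; [SemiAnbd] §3 (slimness), Thm. 6.5 (ii)/(iii),
Thm. 6.8 (compact decomposition groups).

Cell abc-iut, layer L2, seat abc-iut-L2-d3 (gen 5); W3-L2-02 «§2 COVER/ORBIT MODEL», END KNIT. PROOF-ONLY (0 defs).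
For the cover of record `T := MuTwoSetting.CLevelData.temperedCoverData …` (ThetaCoversTemperedOfSetting v2) this
file removes the last two auxiliary binders of the lineage's Cor. 2.9 / Rmk. 2.6.1 results:

* compact `D_x` — now a THEOREM from the parameter bundle `op : OncePuncturedData` (abc-iut-L2-t7's
  `OncePuncturedData.isCompact_decomp`, p440731, via abc-iut-L3's [SemiAnbd] Thm. 6.8 sub-DAG
  `TemperedCurve.decompCompact_of_groupLevelData`): `temperedCoverData_tp_Dx'`, `temperedCoverData_hC1'`,
  `temperedCoverData_hC2'`, `temperedCoverData_exists_cuspDecomp'`;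
* the antecedent `HasMuL` — supplied from «`μ_l ⊆ K`» + the cyclotome identification (`Sec2HasMuLOfSetting`);
  and `IsSlimGroup Π^tp_C` — from `IsSlimGroup Π^tp_X` (`Sec2SlimPiTpC`).

**`temperedCoverData_natCard_cuspOrbits`** — the printed statement at the model: if `K ⊇ μ_l` then for each of
the six members `#(Aut_K(−)-orbits of cusps) = #(ℤ/lℤ)^± = (l+1)/2`, modulo ONLY: the NAMED facts
`IsSlimGroup Π^tp_X` ([SemiAnbd] §3), `T.Prop26` ([EtTh] Prop. 2.6, F-0610), `DecompCommensurablyTerminal` /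
`IsoPreservesCuspidalDecomp` ([SemiAnbd] Thm. 6.5 (ii)/(iii), F-1658/F-1674); the origin clause «`X^log` has a
unique cusp» (census C16); the cyclotome identification datum `CyclotomeMod 1 l` («`Δ_Θ/l ≅ μ_l`»); `l` odd `≠ 1`;
and the standing binders of `T` itself (`op`, P-C3 `hIx`, P-C4 `hιell`, `hN`/`hY`, the splitting `S`).
`temperedCoverData_rmk261_conclusions` — likewise Rmk. 2.6.1's four `Aut_K` computations under «`K ⊇ μ_l`».

HONEST FRAMING: nothing asserts that a `MuTwoSetting` exists or that the named facts hold for an actual curve;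
[EtTh]/[SemiAnbd] are refereed; no side is taken on [IUTchIII] Cor. 3.12; typed ≠ proved elsewhere.
-/

namespace Literature.AnabelianGeometry.EtaleTheta

open Literature.AnabelianGeometry.SemiGraphs ThetaCovers
open Literature.AlgebraicGeometry.Frobenioids (IsSlimGroup)
open Subgroup.Commensurable (commensurator)
open _root_.Topology

namespace MuTwoSetting.CLevelData

variable {p : ℕ} [Fact p.Prime] {M : MuTwoSetting p}
variable {PC : Type} [Group PC] [TopologicalSpace PC] [IsTopologicalGroup PC] [T2Space PC]

section Binders

variable (e : M.CLevelData) (ιC : M.GtpC →ₜ* PC)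
    (hιC : IsProfiniteCompletion ιC) (hinj : Function.Injective ιC) (op : M.toThetaSetting.OncePuncturedData)
    {l : ℕ+} (hodd : Odd (l : ℕ)) {x : M.Pt} (hx : M.IsCusp x)
    (hIx : ((e.piCDataOf ιC hιC).Dx x ⊓ (e.piCDataOf ιC hιC).augGK.ker) ⊔ (e.piCDataOf ιC hιC).barKer l =
      (e.piCDataOf ιC hιC).barTheta l)
    (hιell : ∀ c ∈ (e.piCDataOf ιC hιC).augGK.ker, c ∉ (e.piCDataOf ιC hιC).PiX →
      ∀ d ∈ (e.piCDataOf ιC hιC).PiX ⊓ (e.piCDataOf ιC hιC).augGK.ker,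
        c * d * c⁻¹ * d ∈ (e.piCDataOf ιC hιC).barTheta l)
    (hN : ((M.GtpXu l).map M.inclX).Normal) (hY : (M.GtpY.map M.inclX).Normal) {S : Subgroup PC}
    (hS : ((e.piCDataOf ιC hιC).coverDataAx l op hx hodd hIx hιell
        ((e.piCDataOf ιC hιC).inv_theta_of_inv_ell l op hιell)).toCoverData.IsSplitting S)
    (hSc : IsClosed (S : Set PC))

/-- **`tp D_x = inclX(D_x)`** with compactness of `D_x` from the parameter bundle (abc-iut-L2-t7 / abc-iut-L3,
[SemiAnbd] Thm. 6.8). [cite: MochizukiEtTh2009, Def 2.1 p.35] -/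
theorem temperedCoverData_tp_Dx' :
    (e.temperedCoverData ιC hιC hinj op hodd hx hIx hιell hN hY hS hSc).tp
        (e.temperedCoverData ιC hιC hinj op hodd hx hIx hιell hN hY hS hSc).Dx = (M.decomp x).map M.inclX :=
  temperedCoverData_tp_Dx e ιC hιC hinj op hodd hx hIx hιell hN hY hS hSc (op.isCompact_decomp x)

/-- **`hC1` at the model modulo [SemiAnbd] Thm. 6.5 (ii) alone** (compact `D_x` from the bundle).
[cite: MochizukiEtTh2009, Cor 2.9 p.43] -/
theorem temperedCoverData_hC1' (h65 : M.toTemperedCurve.DecompCommensurablyTerminal) :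
    (e.temperedCoverData ιC hιC hinj op hodd hx hIx hιell hN hY hS hSc).cuspStabC ⊓
        (e.temperedCoverData ιC hιC hinj op hodd hx hIx hιell hN hY hS hSc).tp
          (e.temperedCoverData ιC hιC hinj op hodd hx hIx hιell hN hY hS hSc).PiX ≤
      (e.temperedCoverData ιC hιC hinj op hodd hx hIx hιell hN hY hS hSc).tp
        (e.temperedCoverData ιC hιC hinj op hodd hx hIx hιell hN hY hS hSc).PiXu :=
  temperedCoverData_hC1 e ιC hιC hinj op hodd hx hIx hιell hN hY hS hSc (op.isCompact_decomp x) h65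

/-- **`hC2` at the model modulo «unique cusp» + [SemiAnbd] Thm. 6.5 (iii)** (compact `D_x` from the bundle).
[cite: MochizukiEtTh2009, Cor 2.9 p.43] -/
theorem temperedCoverData_hC2' (huniq : ∀ x' : M.Pt, M.IsCusp x' → x' = x)
    (h65iii : M.toTemperedCurve.IsoPreservesCuspidalDecomp M.toTemperedCurve) :
    ¬ (e.temperedCoverData ιC hιC hinj op hodd hx hIx hιell hN hY hS hSc).cuspStabC ≤
      (e.temperedCoverData ιC hιC hinj op hodd hx hIx hιell hN hY hS hSc).tp
        (e.temperedCoverData ιC hιC hinj op hodd hx hIx hιell hN hY hS hSc).PiX :=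
  temperedCoverData_hC2 e ιC hιC hinj op hodd hx hIx hιell hN hY hS hSc (op.isCompact_decomp x) huniq h65iii

/-- **The C8 datum (B1)–(B3) at the model** with compactness from the bundle.
[cite: MochizukiEtTh2009, Cor 2.9 p.43] -/
theorem temperedCoverData_exists_cuspDecomp' (h65 : M.toTemperedCurve.DecompCommensurablyTerminal)
    (huniq : ∀ x' : M.Pt, M.IsCusp x' → x' = x)
    (h65iii : M.toTemperedCurve.IsoPreservesCuspidalDecomp M.toTemperedCurve) :
    ∃ DC : Subgroup (e.temperedCoverData ιC hιC hinj op hodd hx hIx hιell hN hY hS hSc).Gtp,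
      DC ⊓ (e.temperedCoverData ιC hιC hinj op hodd hx hIx hιell hN hY hS hSc).tp
          (e.temperedCoverData ιC hιC hinj op hodd hx hIx hιell hN hY hS hSc).PiX =
        (e.temperedCoverData ιC hιC hinj op hodd hx hIx hιell hN hY hS hSc).tp
          (e.temperedCoverData ιC hιC hinj op hodd hx hIx hιell hN hY hS hSc).Dx ∧
      ¬ DC ≤ (e.temperedCoverData ιC hιC hinj op hodd hx hIx hιell hN hY hS hSc).tp
          (e.temperedCoverData ιC hιC hinj op hodd hx hIx hιell hN hY hS hSc).PiX ∧
      commensurator DC ≤ DC :=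
  temperedCoverData_exists_cuspDecomp e ιC hιC hinj op hodd hx hIx hιell hN hY hS hSc (op.isCompact_decomp x)
    h65 huniq h65iii

/-- **[EtTh] Cor. 2.9 AT THE §1 MODEL, print-shaped**: if `K` contains a primitive `l`-th root of unity, then
for each of the six members `Ẋ̲̲, Ċ̲, Ċ̲̲, X̲̲, C̲, C̲̲` of the assembled cover the `Aut_K(−)`-orbits of cusps number
`#(ℤ/lℤ)^± = (l+1)/2` — modulo ONLY named facts (slimness of `Π^tp_X`, Prop. 2.6, [SemiAnbd] Thm. 6.5 (ii)/(iii)),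
the origin clause «unique cusp», the cyclotome identification datum, `l` odd `≠ 1`, and `T`'s own binders.
[cite: MochizukiEtTh2009, Cor 2.9 p.43] -/
theorem temperedCoverData_natCard_cuspOrbits (hl : (l : ℕ) ≠ 1) (hX : IsSlimGroup M.PiTemp)
    (h26 : (e.temperedCoverData ιC hιC hinj op hodd hx hIx hιell hN hY hS hSc).Prop26)
    (h65 : M.toTemperedCurve.DecompCommensurablyTerminal)
    (h65iii : M.toTemperedCurve.IsoPreservesCuspidalDecomp M.toTemperedCurve)
    (huniq : ∀ x' : M.Pt, M.IsCusp x' → x' = x)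
    (μ : M.toThetaSetting.CyclotomeMod 1 l) (hμK : ∀ ζ : MuN p l, (((ζ : (PadicAlgCl p)ˣ) : PadicAlgCl p)) ∈ M.K) :
    ∀ S' ∈ [(e.temperedCoverData ιC hιC hinj op hodd hx hIx hιell hN hY hS hSc).tp
          (e.temperedCoverData ιC hιC hinj op hodd hx hIx hιell hN hY hS hSc).PiXuu ⊓
          (e.temperedCoverData ιC hιC hinj op hodd hx hIx hιell hN hY hS hSc).PiCdot,
        (e.temperedCoverData ιC hιC hinj op hodd hx hIx hιell hN hY hS hSc).tp
          (e.temperedCoverData ιC hιC hinj op hodd hx hIx hιell hN hY hS hSc).PiCu ⊓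
          (e.temperedCoverData ιC hιC hinj op hodd hx hIx hιell hN hY hS hSc).PiCdot,
        (e.temperedCoverData ιC hιC hinj op hodd hx hIx hιell hN hY hS hSc).tp
          (e.temperedCoverData ιC hιC hinj op hodd hx hIx hιell hN hY hS hSc).PiCuu ⊓
          (e.temperedCoverData ιC hιC hinj op hodd hx hIx hιell hN hY hS hSc).PiCdot,
        (e.temperedCoverData ιC hιC hinj op hodd hx hIx hιell hN hY hS hSc).tp
          (e.temperedCoverData ιC hιC hinj op hodd hx hIx hιell hN hY hS hSc).PiXuu,
        (e.temperedCoverData ιC hιC hinj op hodd hx hIx hιell hN hY hS hSc).tp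
          (e.temperedCoverData ιC hιC hinj op hodd hx hIx hιell hN hY hS hSc).PiCu,
        (e.temperedCoverData ιC hιC hinj op hodd hx hIx hιell hN hY hS hSc).tp
          (e.temperedCoverData ιC hιC hinj op hodd hx hIx hιell hN hY hS hSc).PiCuu],
      Nat.card ((e.temperedCoverData ιC hιC hinj op hodd hx hIx hιell hN hY hS hSc).cuspOrbits S') =
        ((l : ℕ) + 1) / 2 :=
  temperedCoverData_cor29_card_of_slimX e ιC hιC hinj op hodd hl hx hIx hιell hN hY hS hSc hX h26
    (op.isCompact_decomp x) h65 huniq h65iii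
    (temperedCoverData_hasMuL_of_muL e ιC hιC hinj op hodd hx hIx hιell hN hY hS hSc μ hμK)

/-- **[EtTh] Rmk. 2.6.1 AT THE §1 MODEL, print-shaped** (undotted): if `K ⊇ μ_l` then
`Aut_K(X̲̲) ≅ ℤ/l × ℤ/2`, `Aut_K(X̲) ≅ D_l`, `Aut_K(C̲̲) ≅ ℤ/l`, `Aut_K(C̲) = 1` for the assembled cover — abc-iut-f-144's
`rmk261_ofSetting` with its `HasMuL` antecedent supplied from «`μ_l ⊆ K`». [cite: MochizukiEtTh2009, Rmk 2.6.1 p.40] -/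
theorem temperedCoverData_rmk261_conclusions
    (μ : M.toThetaSetting.CyclotomeMod 1 l) (hμK : ∀ ζ : MuN p l, (((ζ : (PadicAlgCl p)ˣ) : PadicAlgCl p)) ∈ M.K) :
    Nonempty ((e.temperedCoverData ιC hιC hinj op hodd hx hIx hιell hN hY hS hSc).autK
        ((e.temperedCoverData ιC hιC hinj op hodd hx hIx hιell hN hY hS hSc).tp
          (e.temperedCoverData ιC hιC hinj op hodd hx hIx hιell hN hY hS hSc).PiXuu) ≃*
        Multiplicative (ZMod l) × Multiplicative (ZMod 2)) ∧
    Nonempty ((e.temperedCoverData ιC hιC hinj op hodd hx hIx hιell hN hY hS hSc).autK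
        ((e.temperedCoverData ιC hιC hinj op hodd hx hIx hιell hN hY hS hSc).tp
          (e.temperedCoverData ιC hιC hinj op hodd hx hIx hιell hN hY hS hSc).PiXu) ≃* DihedralGroup l) ∧
    Nonempty ((e.temperedCoverData ιC hιC hinj op hodd hx hIx hιell hN hY hS hSc).autK
        ((e.temperedCoverData ιC hιC hinj op hodd hx hIx hιell hN hY hS hSc).tp
          (e.temperedCoverData ιC hιC hinj op hodd hx hIx hιell hN hY hS hSc).PiCuu) ≃*
        Multiplicative (ZMod l)) ∧
    Subsingleton ((e.temperedCoverData ιC hιC hinj op hodd hx hIx hιell hN hY hS hSc).autK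
        ((e.temperedCoverData ιC hιC hinj op hodd hx hIx hιell hN hY hS hSc).tp
          (e.temperedCoverData ιC hιC hinj op hodd hx hIx hιell hN hY hS hSc).PiCu)) :=
  haveI : NeZero (l : ℕ) := ⟨l.ne_zero⟩
  e.rmk261_ofSetting ιC hιC hinj op hodd hx hIx hιell hN hY hS hSc
    (temperedCoverData_hasMuL_of_muL e ιC hιC hinj op hodd hx hIx hιell hN hY hS hSc μ hμK)

end Binders

end MuTwoSetting.CLevelData

end Literature.AnabelianGeometry.EtaleTheta
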